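import Literature.AlgebraicGeometry.Motives.UniversalHypersurfaceRegularLocusChart
import HarnessLib

/-!
# The coefficient vector as an explicit function of the chart coordinates `(b', y)` of `𝒴°(ℂ)`

Family `hodge`, layer `Literature/AlgebraicGeometry/Motives`; sequel of `UniversalHypersurfaceRegularLocusChart` (the charts
`regChartFun n d i = (b', y)`, `b' = (b_m)_{m ≠ xᵢ^d}`, `y = z/zᵢ`, of the regular locus `𝒴°(ℂ)`). On the chart domain `𝒴°(ℂ)ᵢ` the FULL
coefficient vector is a polynomial function of the chart coordinates: the equation `Σ_m b_m z^m = 0`, divided by `zᵢ^d`, reads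
`b_{xᵢ^d} = −Σ_{m ≠ xᵢ^d} b_m (z/zᵢ)^m`. This is the coordinate expression `g ∘ Φᵢ⁻¹` of the coefficient map needed to compute its
differential in the charts (degeneration programme for `HodgeTheory/CyclicCoverNodalMeridianLocalMonodromyBound`; for `(n, d, i) = (2, p, 2)`
and the pencil `x₃^p = f₁ + c x₂^p` it says `c = y₃^p − f₁(y₀, y₁, 1)`).

* `regChartCoeffVec n d i v` — the explicit vector: `v (inl m)` off `xᵢ^d`, `−Σ_{m ≠ xᵢ^d} v(inl m) · Π_k (ins_i 1 y)_k^{m_k}` at `xᵢ^d`;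
* `prod_insertNth_div` — `Π_k (z_k/zᵢ)^{m_k} = (Π_k z_k^{m_k}) / zᵢ^d` for `|m| = d`;
* `regCoeff_eq_regChartCoeffVec` — **`regCoeff Q = regChartCoeffVec (regChartFun Q)` for `Q ∈ 𝒴°(ℂ)ᵢ`**;
* `contDiff_regChartCoeffVec` — the explicit vector is a polynomial, hence `C^∞`, map.

Everything is proved; the one definition is concrete; no named facts.

## References

* [VoisinHodgeII2003] C. Voisin, Hodge Theory and Complex Algebraic Geometry II (2003), §6.2.1, §2.3.
* [SerreGAGA1956] J.-P. Serre, Géométrie algébrique et géométrie analytique, Ann. Inst. Fourier 6 (1956), §2 n°5.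
-/

noncomputable section

open CategoryTheory AlgebraicGeometry MvPolynomial TopologicalSpace Set
open scoped ContDiff
open Literature.AlgebraicGeometry.HodgeTheory Literature.NumberTheory.Transcendental

namespace Literature.AlgebraicGeometry.Motives.UniversalHypersurface

variable (n d : ℕ) (i : Fin (n + 2))

/-- **The coefficient vector in chart coordinates**: off `xᵢ^d` the coordinate itself, at `xᵢ^d` the solved value
`−Σ_{m ≠ xᵢ^d} b_m · (ins_i 1 y)^m`. [cite: VoisinHodgeII2003, §6.2.1] -/
def regChartCoeffVec (v : ({m : DegIndex n d // m ≠ regPowIndex n d i} ⊕ Fin (n + 1)) → ℂ) : DegIndex n d → ℂ :=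
  fun m =>
    if h : m = regPowIndex n d i then
      -∑ m' : {m : DegIndex n d // m ≠ regPowIndex n d i},
        v (Sum.inl m') * (m'.1.1.prod fun k e => (Fin.insertNth i (1 : ℂ) (fun j => v (Sum.inr j)) : Fin (n + 2) → ℂ) k ^ e)
    else v (Sum.inl ⟨m, h⟩)

/-- Off `xᵢ^d` the vector is the coordinate. [cite: VoisinHodgeII2003, §6.2.1] -/
theorem regChartCoeffVec_of_ne (v : ({m : DegIndex n d // m ≠ regPowIndex n d i} ⊕ Fin (n + 1)) → ℂ) {m : DegIndex n d}
    (h : m ≠ regPowIndex n d i) : regChartCoeffVec n d i v m = v (Sum.inl ⟨m, h⟩) := by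
  classical
  simp [regChartCoeffVec, h]

/-- At `xᵢ^d` the vector is the solved value. [cite: VoisinHodgeII2003, §6.2.1] -/
theorem regChartCoeffVec_regPowIndex (v : ({m : DegIndex n d // m ≠ regPowIndex n d i} ⊕ Fin (n + 1)) → ℂ) :
    regChartCoeffVec n d i v (regPowIndex n d i) =
      -∑ m' : {m : DegIndex n d // m ≠ regPowIndex n d i},
        v (Sum.inl m') * (m'.1.1.prod fun k e => (Fin.insertNth i (1 : ℂ) (fun j => v (Sum.inr j)) : Fin (n + 2) → ℂ) k ^ e) := by
  classical
  simp [regChartCoeffVec]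

/-- `Π_k (c · z_k)^{m_k} = c^d · Π_k z_k^{m_k}` for `|m| = d`. [cite: VoisinHodgeII2003, §6.2.1] -/
theorem prod_smul_pow (m : DegIndex n d) (c : ℂ) (z : Fin (n + 2) → ℂ) :
    (m.1.prod fun k e => (c * z k) ^ e) = c ^ d * m.1.prod fun k e => z k ^ e := by
  rw [Finsupp.prod_pow, Finsupp.prod_pow]
  simp only [mul_pow, Finset.prod_mul_distrib, Finset.prod_pow_eq_pow_sum]
  congr 1
  rw [← Finsupp.degree_eq_sum, m.2]

/-- For `zᵢ ≠ 0`, `ins_i 1 ((z_{succAbove j}/zᵢ)_j) = zᵢ⁻¹ · z`. [cite: SerreGAGA1956, §2 n°5] -/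
theorem insertNth_one_div (z : Fin (n + 2) → ℂ) (hz : z i ≠ 0) :
    (Fin.insertNth i (1 : ℂ) (fun j => z (i.succAbove j) / z i) : Fin (n + 2) → ℂ) = fun k => (z i)⁻¹ * z k := by
  funext k
  refine Fin.succAboveCases i ?_ (fun j => ?_) k
  · rw [Fin.insertNth_apply_same, inv_mul_cancel₀ hz]
  · rw [Fin.insertNth_apply_succAbove, div_eq_inv_mul]

/-- **On `𝒴°(ℂ)ᵢ` the coefficient vector is `regChartCoeffVec` of the chart coordinates**: `b_{xᵢ^d} = −Σ_{m ≠ xᵢ^d} b_m (z/zᵢ)^m` (the equation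
`Σ_m b_m z^m = 0` divided by `zᵢ^d`), the other coefficients being chart coordinates. [cite: VoisinHodgeII2003, §6.2.1] -/
theorem regCoeff_eq_regChartCoeffVec {Q : ComplexPoints (regularTotal ℂ n d)} (hQ : Q ∈ regChartDom n d i) :
    regCoeff ℂ n d Q = regChartCoeffVec n d i (regChartFun n d i Q) := by
  classical
  funext m
  by_cases hm : m = regPowIndex n d i
  · subst hm
    rw [regChartCoeffVec_regPowIndex]
    -- the affine coordinates and the representative
    set z := (hypersurfacePoint (regularToProjectiveSpace ℂ n d) Q).rep with hzdef
    have hzi : z i ≠ 0 := by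
      rw [regChartDom_eq_preimage, Set.mem_preimage, Projectivization.stdChart_source] at hQ
      exact hQ
    have hy : (fun j => regChartFun n d i Q (Sum.inr j)) = fun j => z (i.succAbove j) / z i := by
      funext j
      change Projectivization.stdChart i (hypersurfacePoint (regularToProjectiveSpace ℂ n d) Q) j = _
      rw [Projectivization.stdChart_apply]
      rfl
    have hins : (Fin.insertNth i (1 : ℂ) (fun j => regChartFun n d i Q (Sum.inr j)) : Fin (n + 2) → ℂ) =
        fun k => (z i)⁻¹ * z k := by
      rw [hy, insertNth_one_div n i z hzi]
    -- the equation divided by `zᵢ^d`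
    have hE := eval_rep_formOfCoeffs_regCoeff n d Q
    rw [eval_formOfCoeffs, Fintype.sum_eq_add_sum_subtype_ne _ (regPowIndex n d i), prod_regPowIndex] at hE
    have hzid : z i ^ d ≠ 0 := pow_ne_zero d hzi
    have hterm : ∀ m' : {m : DegIndex n d // m ≠ regPowIndex n d i},
        regChartFun n d i Q (Sum.inl m') *
            (m'.1.1.prod fun k e => (Fin.insertNth i (1 : ℂ) (fun j => regChartFun n d i Q (Sum.inr j)) : Fin (n + 2) → ℂ) k ^ e) =
          (z i ^ d)⁻¹ * (regCoeff ℂ n d Q m'.1 * m'.1.1.prod fun k e => z k ^ e) := by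
      intro m'
      rw [hins, prod_smul_pow n d m'.1 (z i)⁻¹ z, inv_pow]
      change regCoeff ℂ n d Q m'.1 * _ = _
      ring
    simp only [hterm, ← Finset.mul_sum]
    have hsum : ∑ m' : {m : DegIndex n d // m ≠ regPowIndex n d i}, regCoeff ℂ n d Q m'.1 * m'.1.1.prod (fun k e => z k ^ e) =
        -(regCoeff ℂ n d Q (regPowIndex n d i) * z i ^ d) := by
      linear_combination hE
    rw [hsum]
    field_simp
  · rw [regChartCoeffVec_of_ne n d i _ hm]
    rfl

/-- The explicit vector is `C^∞` (a polynomial map). [cite: VoisinHodgeII2003, §6.2.1] -/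
theorem contDiff_regChartCoeffVec : ContDiff ℝ ∞ (regChartCoeffVec n d i) := by
  classical
  rw [contDiff_pi]
  intro m
  by_cases hm : m = regPowIndex n d i
  · subst hm
    have hfun : (fun v => regChartCoeffVec n d i v (regPowIndex n d i)) = fun v =>
        -∑ m' : {m : DegIndex n d // m ≠ regPowIndex n d i},
          v (Sum.inl m') * (m'.1.1.prod fun k e => (Fin.insertNth i (1 : ℂ) (fun j => v (Sum.inr j)) : Fin (n + 2) → ℂ) k ^ e) :=
      funext fun v => regChartCoeffVec_regPowIndex n d i v
    rw [hfun]
    refine ContDiff.neg (ContDiff.sum fun m' _ => ?_)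
    refine ((contDiff_apply ℝ ℂ (Sum.inl m' : {m : DegIndex n d // m ≠ regPowIndex n d i} ⊕ Fin (n + 1))).mul ?_)
    rw [show (fun v : ({m : DegIndex n d // m ≠ regPowIndex n d i} ⊕ Fin (n + 1)) → ℂ =>
        m'.1.1.prod fun k e => (Fin.insertNth i (1 : ℂ) (fun j => v (Sum.inr j)) : Fin (n + 2) → ℂ) k ^ e) =
        fun v => ∏ k, (Fin.insertNth i (1 : ℂ) (fun j => v (Sum.inr j)) : Fin (n + 2) → ℂ) k ^ m'.1.1 k from
      funext fun v => Finsupp.prod_pow _ _]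
    refine contDiff_prod fun k _ => ContDiff.pow ?_ _
    refine Fin.succAboveCases i ?_ (fun j => ?_) k
    · simp only [Fin.insertNth_apply_same]
      exact contDiff_const
    · simp only [Fin.insertNth_apply_succAbove]
      exact contDiff_apply ℝ ℂ (Sum.inr j : {m : DegIndex n d // m ≠ regPowIndex n d i} ⊕ Fin (n + 1))
  · have hfun : (fun v => regChartCoeffVec n d i v m) = fun v => v (Sum.inl ⟨m, hm⟩) :=
      funext fun v => regChartCoeffVec_of_ne n d i v hm
    rw [hfun]
    exact contDiff_apply ℝ ℂ
      (Sum.inl (⟨m, hm⟩ : {m : DegIndex n d // m ≠ regPowIndex n d i}) :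
        {m : DegIndex n d // m ≠ regPowIndex n d i} ⊕ Fin (n + 1))

end Literature.AlgebraicGeometry.Motives.UniversalHypersurface

end
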